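import Summits.CriticalPhenomena.PercolationContinuityZ3.Theorems.PercNearOneGluingNoHeavyLowerTailCornerRealizers
import HarnessLib

/-!
# `NoHeavyLowerTail` (stmt-CriticalPhenomena-4575) — corner programme, layer 5a:
# up-families for the CUMULATIVE ISOLATION inequality (CIL) and their no-three-antichain at the half level

CIL at level `j`: `P(1 ≤ |π(o)| ≤ j) ≤ max_{a ∈ A} P(|π(a)| ≤ j)` (`π(v) = C(v) ∩ A`); at the half level
`j = ⌊|A|/2⌋` it closes the crux (`…CILReduction`, `stub_cumulativeIsolation`).  This file carries the realizer
bookkeeping of layer 3a over from the exit event to the CIL events: `lightEvent A j x = {|π(x)| ≤ j}`,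
`cilEvent A j o = {1 ≤ |π(o)| ≤ j}`, the up-families `upFamL` (`order-m realizers of {a light} whose a-cluster contains o`),
`R_m(cilEvent) = ⋃_a upFamL a`, and the NO-THREE-ANTICHAIN theorem `upFamL_no_three_antichain` AT THE HALF LEVEL
`2j ≤ |A| ≤ 2j+1`: the extra point over layer 3a is the union step — a vertex set holding `t` and at most `2j − 1`
relays has at least `m` boundary pairs, either directly (`≤ j` relays: it realizes `{t light}`) or through its
COMPLEMENT (`≥ j+1` relays inside ⇒ `≤ j` and `≥ 1` relays outside).  [folklore] bookkeeping; nothing about the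
crux is asserted.
-/

noncomputable section

namespace Summit.CriticalPhenomena.PercolationContinuityZ3.Theorems

open MeasureTheory Filter Topology Finset
open Literature.Probability.LatticeModels Literature.Probability.Percolation

namespace Corner

open scoped Classical

variable {V : Type*} [Fintype V] [DecidableEq V]

/-! ### The CIL events -/

/-- `{|π(x)| ≤ j}`: the open cluster of `x` holds at most `j` relays (the form used by `giantDiamond`). [folklore] -/
def lightEvent (A : Finset V) (j : ℕ) (x : V) : Set (BondConfig V) :=
  {ω | (A.filter fun z => ω ∈ openConn x z).card ≤ j}

/-- `{1 ≤ |π(o)| ≤ j}`: the CIL event at level `j`. [folklore] -/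
def cilEvent (A : Finset V) (j : ℕ) (o : V) : Set (BondConfig V) :=
  {ω | 1 ≤ (A.filter fun z => ω ∈ openConn o z).card ∧ (A.filter fun z => ω ∈ openConn o z).card ≤ j}

/-- The relay content of a cluster: `π(x)` as a filter equals `A ∩ C(x)`. [folklore] -/
theorem filter_openConn_eq_inter (A : Finset V) (ω : BondConfig V) (x : V) :
    (A.filter fun z => ω ∈ openConn x z) = A ∩ clus ω x := by
  ext z
  simp only [Finset.mem_filter, Finset.mem_inter, mem_clus, openConn, Set.mem_setOf_eq]

/-- Joined vertices have the same relay content. [folklore] -/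
theorem clus_eq_of_reachable {ω : BondConfig V} {x y : V} (h : (openGraph ω).Reachable x y) :
    clus ω x = clus ω y := by
  ext z; simp only [mem_clus]; exact ⟨fun hz => h.symm.trans hz, fun hz => h.trans hz⟩

/-! ### Up-families for the light events -/

/-- The up-family of the relay `a` for CIL: order-`m` realizers of `{a light}` whose `a`-cluster contains `o`. [folklore] -/
def upFamL (E : Finset (Sym2 V)) (m : ℕ) (o : V) (A : Finset V) (j : ℕ) (a : V) : Finset (Finset (Sym2 V)) :=
  (realizers E (lightEvent A j a) m).filter fun S => o ∈ clus (↑S : Set (Sym2 V)) a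

/-- Membership in the CIL up-family. [folklore] -/
theorem mem_upFamL {E : Finset (Sym2 V)} {m : ℕ} {o : V} {A : Finset V} {j : ℕ} {a : V} {S : Finset (Sym2 V)} :
    S ∈ upFamL E m o A j a ↔ S ⊆ E ∧ (A ∩ clus (↑S : Set (Sym2 V)) a).card ≤ j ∧ (E \ S).card = m ∧
      (openGraph (↑S : Set (Sym2 V))).Reachable a o := by
  simp only [upFamL, Finset.mem_filter, mem_realizers, mem_clus, lightEvent, Set.mem_setOf_eq,
    filter_openConn_eq_inter, and_assoc]

/-- The up-family lies in the realizer family of `{a light}`. [folklore] -/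
theorem upFamL_subset (E : Finset (Sym2 V)) (m : ℕ) (o : V) (A : Finset V) (j : ℕ) (a : V) :
    upFamL E m o A j a ⊆ realizers E (lightEvent A j a) m := Finset.filter_subset _ _

/-- **The order-`m` realizers of the CIL event are the union of the up-families.** [folklore] -/
theorem mem_realizers_cil_iff {E : Finset (Sym2 V)} {m : ℕ} {o : V} {A : Finset V} {j : ℕ} {S : Finset (Sym2 V)} :
    S ∈ realizers E (cilEvent A j o) m ↔ ∃ a ∈ A, S ∈ upFamL E m o A j a := by
  constructor
  · intro h
    obtain ⟨hSE, hX, hcard⟩ := mem_realizers.1 h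
    simp only [cilEvent, Set.mem_setOf_eq, filter_openConn_eq_inter] at hX
    obtain ⟨h1, hj⟩ := hX
    obtain ⟨a, ha⟩ := Finset.card_pos.1 h1
    rw [Finset.mem_inter] at ha
    refine ⟨a, ha.1, mem_upFamL.2 ⟨hSE, ?_, hcard, (mem_clus.1 ha.2).symm⟩⟩
    rwa [← clus_eq_of_reachable (mem_clus.1 ha.2)]
  · rintro ⟨a, ha, h⟩
    obtain ⟨hSE, hj, hcard, hao⟩ := mem_upFamL.1 h
    refine mem_realizers.2 ⟨hSE, ?_, hcard⟩
    simp only [cilEvent, Set.mem_setOf_eq, filter_openConn_eq_inter]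
    rw [← clus_eq_of_reachable hao]
    exact ⟨Finset.card_pos.2 ⟨a, Finset.mem_inter.2 ⟨ha, mem_clus.2 SimpleGraph.Reachable.rfl⟩⟩, hj⟩

/-- Inside an up-family, membership in another one is read off the `o`-cluster. [folklore] -/
theorem mem_upFamL_iff_mem_clus {E : Finset (Sym2 V)} {m : ℕ} {o : V} {A : Finset V} {j : ℕ} {a t : V}
    {S : Finset (Sym2 V)} (hS : S ∈ upFamL E m o A j a) :
    S ∈ upFamL E m o A j t ↔ t ∈ clus (↑S : Set (Sym2 V)) o := by
  obtain ⟨hSE, hj, hcard, hao⟩ := mem_upFamL.1 hS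
  rw [mem_clus, mem_upFamL]
  constructor
  · rintro ⟨-, -, -, hto⟩; exact hto.symm
  · intro hot
    refine ⟨hSE, ?_, hcard, hot.symm⟩
    rwa [clus_eq_of_reachable (hot.symm.trans hao.symm)]

/-! ### Vertex cut bounds from the order of a light event -/

/-- If `{t light}` has order `≥ m`, every vertex set holding `t` and at most `j` relays has `≥ m` boundary pairs. [folklore] -/
theorem le_card_bdry_of_light {E : Finset (Sym2 V)} {A : Finset V} {j m : ℕ} {t : V}
    (hm : ∀ T ∈ E.powerset, (↑T : Set (Sym2 V)) ∈ lightEvent A j t → m ≤ (E \ T).card)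
    {W : Finset V} (ht : t ∈ W) (hW : (A ∩ W).card ≤ j) : m ≤ (bdry E W).card := by
  have h := hm (E \ bdry E W) (Finset.mem_powerset.2 Finset.sdiff_subset) (by
    simp only [lightEvent, Set.mem_setOf_eq, filter_openConn_eq_inter]
    exact (Finset.card_le_card (Finset.inter_subset_inter_left (clus_sdiff_bdry_subset E W ht))).trans hW)
  rwa [card_sdiff_sdiff_bdry] at h

/-- **The union step at the half level.** If `2j ≤ |A| ≤ 2j+1`, every light event has order `≥ m`, and `W` holds the
relay `t` and at most `2j − 1` relays, then `W` has `≥ m` boundary pairs (directly if `≤ j` relays; else through the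
complement, which holds between `1` and `j` relays). [folklore] -/
theorem le_card_bdry_of_few_relays {E : Finset (Sym2 V)} {A : Finset V} {j m : ℕ}
    (hA : 2 * j ≤ A.card ∧ A.card ≤ 2 * j + 1)
    (hm : ∀ a ∈ A, ∀ T ∈ E.powerset, (↑T : Set (Sym2 V)) ∈ lightEvent A j a → m ≤ (E \ T).card)
    {W : Finset V} {t : V} (htA : t ∈ A) (ht : t ∈ W) (hW : (A ∩ W).card ≤ 2 * j - 1) : m ≤ (bdry E W).card := by
  by_cases hj : (A ∩ W).card ≤ j
  · exact le_card_bdry_of_light (hm t htA) ht hj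
  · -- complement: a relay outside, and at most j relays outside
    have hlt : (A ∩ W).card < A.card := by
      have h1 : 1 ≤ (A ∩ W).card := Finset.card_pos.2 ⟨t, Finset.mem_inter.2 ⟨htA, ht⟩⟩
      omega
    have hne : (A \ W).Nonempty := by
      rw [← Finset.card_pos]
      have hsd := Finset.card_sdiff_add_card_inter A W
      omega
    obtain ⟨a', ha'⟩ := hne
    rw [Finset.mem_sdiff] at ha'
    have hcompl : (A ∩ Wᶜ).card ≤ j := by
      have hsplit : (A ∩ W).card + (A ∩ Wᶜ).card = A.card := by
        rw [← Finset.card_union_of_disjoint (Finset.disjoint_left.2 fun z h1 h2 =>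
          (Finset.mem_compl.1 (Finset.mem_inter.1 h2).2) (Finset.mem_inter.1 h1).2)]
        congr 1; ext z
        simp only [Finset.mem_union, Finset.mem_inter, Finset.mem_compl]
        tauto
      omega
    rw [← bdry_compl]
    exact le_card_bdry_of_light (hm a' ha'.1) (Finset.mem_compl.2 ha'.2) hcompl

/-! ### No three-antichain at the half level -/

/-- For `S ∈ upFamL a`: the `o`-cluster contains `a`, holds `≤ j` relays, and has exactly `m` boundary pairs. [folklore] -/
theorem clus_facts_of_mem_upFamL {E : Finset (Sym2 V)} {m : ℕ} {o : V} {A : Finset V} {j : ℕ} {a : V}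
    {S : Finset (Sym2 V)} (hS : S ∈ upFamL E m o A j a) (haA : a ∈ A)
    (hma : ∀ T ∈ E.powerset, (↑T : Set (Sym2 V)) ∈ lightEvent A j a → m ≤ (E \ T).card) :
    a ∈ clus (↑S : Set (Sym2 V)) o ∧ (A ∩ clus (↑S : Set (Sym2 V)) o).card ≤ j ∧
      (bdry E (clus (↑S : Set (Sym2 V)) o)).card = m := by
  obtain ⟨hSE, hj, hcard, hao⟩ := mem_upFamL.1 hS
  have ha : a ∈ clus (↑S : Set (Sym2 V)) o := mem_clus.2 hao.symm
  have hj' : (A ∩ clus (↑S : Set (Sym2 V)) o).card ≤ j := by rwa [← clus_eq_of_reachable hao]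
  refine ⟨ha, hj', le_antisymm ?_ (le_card_bdry_of_light hma ha hj')⟩
  have _ := haA
  calc (bdry E (clus (↑S : Set (Sym2 V)) o)).card ≤ (E \ S).card := card_bdry_clus_le_card_sdiff o
    _ = m := hcard

/-- **No three-antichain for the CIL up-families at the half level.** [folklore] -/
theorem upFamL_no_three_antichain (E : Finset (Sym2 V)) (m : ℕ) (o : V) (A : Finset V) (j : ℕ)
    (hA : 2 * j ≤ A.card ∧ A.card ≤ 2 * j + 1)
    (hm : ∀ a ∈ A, ∀ T ∈ E.powerset, (↑T : Set (Sym2 V)) ∈ lightEvent A j a → m ≤ (E \ T).card)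
    {t₁ t₂ t₃ : V} (h₁ : t₁ ∈ A) (h₂ : t₂ ∈ A) (h₃ : t₃ ∈ A)
    (h₁₂ : ¬ upFamL E m o A j t₁ ⊆ upFamL E m o A j t₂) (h₂₁ : ¬ upFamL E m o A j t₂ ⊆ upFamL E m o A j t₁)
    (h₁₃ : ¬ upFamL E m o A j t₁ ⊆ upFamL E m o A j t₃) (h₃₁ : ¬ upFamL E m o A j t₃ ⊆ upFamL E m o A j t₁)
    (h₂₃ : ¬ upFamL E m o A j t₂ ⊆ upFamL E m o A j t₃) (h₃₂ : ¬ upFamL E m o A j t₃ ⊆ upFamL E m o A j t₂) :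
    False := by
  -- witnesses
  have wit : ∀ {t t' : V}, t ∈ A → ¬ upFamL E m o A j t ⊆ upFamL E m o A j t' →
      ∃ S : Finset (Sym2 V), S ∈ upFamL E m o A j t ∧ o ∈ clus (↑S : Set (Sym2 V)) o ∧
        t ∈ clus (↑S : Set (Sym2 V)) o ∧ t' ∉ clus (↑S : Set (Sym2 V)) o ∧
        (A ∩ clus (↑S : Set (Sym2 V)) o).card ≤ j ∧ (bdry E (clus (↑S : Set (Sym2 V)) o)).card = m := by
    intro t t' htA hns
    obtain ⟨S, hS, hS'⟩ := Finset.not_subset.1 hns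
    obtain ⟨ht, hj, hc⟩ := clus_facts_of_mem_upFamL hS htA (hm t htA)
    exact ⟨S, hS, mem_clus.2 SimpleGraph.Reachable.rfl, ht, fun h => hS' ((mem_upFamL_iff_mem_clus hS).2 h), hj, hc⟩
  obtain ⟨S₁₂, hS₁₂, ho₁₂, ht₁₂, hn₁₂, hj₁₂, hc₁₂⟩ := wit h₁ h₁₂
  obtain ⟨S₁₃, -, ho₁₃, ht₁₃, hn₁₃, hj₁₃, hc₁₃⟩ := wit h₁ h₁₃
  obtain ⟨S₂₁, -, ho₂₁, ht₂₁, hn₂₁, hj₂₁, hc₂₁⟩ := wit h₂ h₂₁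
  obtain ⟨S₂₃, -, ho₂₃, ht₂₃, hn₂₃, hj₂₃, hc₂₃⟩ := wit h₂ h₂₃
  obtain ⟨S₃₁, -, ho₃₁, ht₃₁, hn₃₁, hj₃₁, hc₃₁⟩ := wit h₃ h₃₁
  obtain ⟨S₃₂, -, ho₃₂, ht₃₂, hn₃₂, hj₃₂, hc₃₂⟩ := wit h₃ h₃₂
  set U₁₂ := clus (↑S₁₂ : Set (Sym2 V)) o
  set U₁₃ := clus (↑S₁₃ : Set (Sym2 V)) o
  set U₂₁ := clus (↑S₂₁ : Set (Sym2 V)) o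
  set U₂₃ := clus (↑S₂₃ : Set (Sym2 V)) o
  set U₃₁ := clus (↑S₃₁ : Set (Sym2 V)) o
  set U₃₂ := clus (↑S₃₂ : Set (Sym2 V)) o
  -- generic lower bound for sets holding t with ≤ j relays
  have low_set : ∀ (t : V), t ∈ A → ∀ (W : Finset V), t ∈ W → (A ∩ W).card ≤ j → m ≤ (bdry E W).card :=
    fun t htA W hW hc => le_card_bdry_of_light (hm t htA) hW hc
  -- intersections have cut m
  have inter_eq : ∀ (t : V), t ∈ A → ∀ (P Q : Finset V), t ∈ P → t ∈ Q → (A ∩ P).card ≤ j → (A ∩ Q).card ≤ j →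
      (bdry E P).card = m → (bdry E Q).card = m → (bdry E (P ∩ Q)).card = m := by
    intro t htA P Q htP htQ hP hQ hcP hcQ
    have hsub := card_bdry_inter_add_union_le E P Q
    have hi : m ≤ (bdry E (P ∩ Q)).card :=
      low_set t htA _ (Finset.mem_inter.2 ⟨htP, htQ⟩) ((Finset.card_le_card (Finset.inter_subset_inter_left
        Finset.inter_subset_left)).trans hP)
    have hu : m ≤ (bdry E (P ∪ Q)).card := by
      refine le_card_bdry_of_few_relays hA hm htA (Finset.mem_union_left _ htP) ?_
      have hcard : (A ∩ (P ∪ Q)).card + (A ∩ (P ∩ Q)).card = (A ∩ P).card + (A ∩ Q).card := by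
        rw [Finset.inter_union_distrib_left, show A ∩ (P ∩ Q) = (A ∩ P) ∩ (A ∩ Q) by
          ext z; simp only [Finset.mem_inter]; tauto]
        exact Finset.card_union_add_card_inter _ _
      have h1 : 1 ≤ (A ∩ (P ∩ Q)).card := Finset.card_pos.2 ⟨t, Finset.mem_inter.2 ⟨htA, Finset.mem_inter.2 ⟨htP, htQ⟩⟩⟩
      omega
    omega
  have c₁ : (bdry E (U₁₂ ∩ U₁₃)).card = m := inter_eq t₁ h₁ _ _ ht₁₂ ht₁₃ hj₁₂ hj₁₃ hc₁₂ hc₁₃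
  have c₂ : (bdry E (U₂₁ ∩ U₂₃)).card = m := inter_eq t₂ h₂ _ _ ht₂₁ ht₂₃ hj₂₁ hj₂₃ hc₂₁ hc₂₃
  have c₃ : (bdry E (U₃₁ ∩ U₃₂)).card = m := inter_eq t₃ h₃ _ _ ht₃₁ ht₃₂ hj₃₁ hj₃₂ hc₃₁ hc₃₂
  have m₁ : t₁ ∈ U₁₂ ∩ U₁₃ := Finset.mem_inter.2 ⟨ht₁₂, ht₁₃⟩
  have m₂ : t₂ ∈ U₂₁ ∩ U₂₃ := Finset.mem_inter.2 ⟨ht₂₁, ht₂₃⟩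
  have m₃ : t₃ ∈ U₃₁ ∩ U₃₂ := Finset.mem_inter.2 ⟨ht₃₁, ht₃₂⟩
  have n₁₂ : t₁ ∉ U₂₁ ∩ U₂₃ := fun h => hn₂₁ (Finset.mem_inter.1 h).1
  have n₁₃ : t₁ ∉ U₃₁ ∩ U₃₂ := fun h => hn₃₁ (Finset.mem_inter.1 h).1
  have n₂₁ : t₂ ∉ U₁₂ ∩ U₁₃ := fun h => hn₁₂ (Finset.mem_inter.1 h).1
  have n₂₃ : t₂ ∉ U₃₁ ∩ U₃₂ := fun h => hn₃₂ (Finset.mem_inter.1 h).2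
  have n₃₁ : t₃ ∉ U₁₂ ∩ U₁₃ := fun h => hn₁₃ (Finset.mem_inter.1 h).2
  have n₃₂ : t₃ ∉ U₂₁ ∩ U₂₃ := fun h => hn₂₃ (Finset.mem_inter.1 h).2
  -- relay-count bounds for sub-sets of the U_i
  have jc₁ : (A ∩ (U₁₂ ∩ U₁₃)).card ≤ j :=
    (Finset.card_le_card (Finset.inter_subset_inter_left Finset.inter_subset_left)).trans hj₁₂
  have jc₂ : (A ∩ (U₂₁ ∩ U₂₃)).card ≤ j :=
    (Finset.card_le_card (Finset.inter_subset_inter_left Finset.inter_subset_left)).trans hj₂₁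
  have jc₃ : (A ∩ (U₃₁ ∩ U₃₂)).card ≤ j :=
    (Finset.card_le_card (Finset.inter_subset_inter_left Finset.inter_subset_left)).trans hj₃₁
  have low : ∀ (t : V), t ∈ A → ∀ (P Q : Finset V), t ∈ P → t ∉ Q → (A ∩ P).card ≤ j →
      (m : ℤ) ≤ ∑ u, ∑ v, if u ∈ P \ Q ∧ v ∈ (P \ Q)ᶜ then (↑(mult E u v) : ℤ) else 0 := by
    intro t htA P Q htP htQ hP
    rw [← card_bdry_eq_adj]
    exact_mod_cast low_set t htA _ (Finset.mem_sdiff.2 ⟨htP, htQ⟩)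
      ((Finset.card_le_card (Finset.inter_subset_inter_left Finset.sdiff_subset)).trans hP)
  have eqm : ∀ {P : Finset V}, (bdry E P).card = m →
      (∑ u, ∑ v, if u ∈ P ∧ v ∈ Pᶜ then (↑(mult E u v) : ℤ) else 0) = (m : ℤ) := by
    intro P hP; rw [← card_bdry_eq_adj, hP]
  have hz := cut_inter₃_eq_zero (mult E) (mult_comm E) (U₁₂ ∩ U₁₃) (U₂₁ ∩ U₂₃) (U₃₁ ∩ U₃₂) (m : ℤ)
    (eqm c₁) (eqm c₂) (eqm c₃)
    (low t₁ h₁ _ _ m₁ n₁₂ jc₁) (low t₂ h₂ _ _ m₂ n₂₁ jc₂) (low t₁ h₁ _ _ m₁ n₁₃ jc₁) (low t₃ h₃ _ _ m₃ n₃₁ jc₃)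
    (low t₂ h₂ _ _ m₂ n₂₃ jc₂) (low t₃ h₃ _ _ m₃ n₃₂ jc₃)
    (low t₁ h₁ _ _ m₁ (by rw [Finset.mem_union, not_or]; exact ⟨n₁₂, n₁₃⟩) jc₁)
    (low t₂ h₂ _ _ m₂ (by rw [Finset.mem_union, not_or]; exact ⟨n₂₁, n₂₃⟩) jc₂)
    (low t₃ h₃ _ _ m₃ (by rw [Finset.mem_union, not_or]; exact ⟨n₃₁, n₃₂⟩) jc₃)
  set Z := U₁₂ ∩ U₁₃ ∩ (U₂₁ ∩ U₂₃) ∩ (U₃₁ ∩ U₃₂) with hZ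
  have hZ0 : (bdry E Z).card = 0 := by
    have h := card_bdry_eq_adj E Z
    rw [hz] at h
    exact_mod_cast h
  have hoZ : o ∈ Z := by
    simp only [hZ, Finset.mem_inter]
    exact ⟨⟨⟨ho₁₂, ho₁₃⟩, ho₂₁, ho₂₃⟩, ho₃₁, ho₃₂⟩
  have ht₁Z : t₁ ∈ Z :=
    reachable_mem_of_card_bdry_eq_zero (mem_upFamL.1 hS₁₂).1 hZ0 (mem_clus.1 ht₁₂) hoZ
  have : t₁ ∈ U₂₁ := (Finset.mem_inter.1 (Finset.mem_inter.1 (Finset.mem_inter.1 ht₁Z).1).2).1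
  exact hn₂₁ this

end Corner

end Summit.CriticalPhenomena.PercolationContinuityZ3.Theorems

end
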